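import Mathlib
import Summits.MatrixMultiplication.MatrixMultiplication.Theorems.SnSubsetDichotomyPolynomialSlackRowsKept
import Summits.MatrixMultiplication.MatrixMultiplication.Theorems.SnSubsetDichotomyPolynomialSlackCostsCertified

/-!
# The hub rows and hub columns of the 3/4 step: rate box and the two halves of the cover

Crux `Summit.MatrixMultiplication.MatrixMultiplication.Theses.SnSubsetDichotomy.PolynomialSlack`
(item `stmt-MatrixMultiplication-8306`), level-one programme, line transport-split-hull (lead c10).
Two steps of the assembly `volume_le_of_atoms_trichotomy`:

* `rows_rate_le` — the right-hand side of `rows_kept_le` carries, for every hub row `k ∈ R`, the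
  entropy costs `Σ_{included T-levels a} σ'(k,a) (1 - log x(k,a)/log n)` and
  `Σ_{included S-levels b} ρ'(k,b) (1 - log y(k,b)/log n)`; by the rate box of the included levels
  (`incl_rate_bounds_masked`: `log x, log y ≤ 0.755 log n` under the no-win hypothesis `W < N`) each
  cost is at least `0.245` times the corresponding INCLUDED MASS `Σ σ'`, `Σ ρ'`.  Summed over
  `k ∈ R` this is the bootstrap inequality `0.245 · MASS ≤ COST`; stated for a general triple, mask
  `Qm` and row set `R`.
* `atomsTrichotomy_halves` — the two hub terms of `trichotomy_cover` bounded at once: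
  `rows_kept_le` + `rows_rate_le` for the hub rows `R` of `(S, T, U)` (mask `Q`) and for the hub
  columns `Q`, i.e. the hub rows of the REVERSED triple `(U, T, S)` (mask `∅`; `tpp_reverse`,
  `reversed_profiles`: its profiles are the transposes `dB°ᵀ, dAᵀ, dCᵀ`, its volume is `N`, its
  first co-density is `K_B`), and `costs_certified_with_mass` for the four entropy costs; the level
  data (fourteen block-sum functions) stay internal and only `COST`, `MASS ≥ 0` are exported:
  `0.245 MASS ≤ COST`, `COST log n ≤ log K_A + log K_B + log K_C + MASS log((2|R|+2|Q|+2)/ε₁) + 6`,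
  `ROWS + COLS ≤ 5/8 COST + slop(|R|) + slop(|Q|)`.
-/

namespace Summit.MatrixMultiplication.MatrixMultiplication.Theorems.PolynomialSlack

open scoped BigOperators
open Literature.Combinatorics.Additive (TripleProductProperty)

set_option linter.dupNamespace false

/-- **Rate box, summed over the hub rows: the entropy costs of the included levels are at least
`0.245` times the included masses.** [folklore] -/
theorem rows_rate_le {n : ℕ} (hn : 2 ≤ n) (B : ℕ) (hB : ∀ S' T' U' : Finset (Equiv.Perm (Fin (n - 1))), TripleProductProperty S' T' U' → S'.card * T'.card * U'.card ≤ B) {S T U : Finset (Equiv.Perm (Fin n))} (hTPP : TripleProductProperty S T U) (hS0 : S.Nonempty) (hT0 : T.Nonempty) (hU0 : U.Nonempty) (dA dB dC pB pC : Fin n → Fin n → ℝ) (hdA : ∀ i j, dA i j = (((S ×ˢ T).filter fun st => st.2 j = st.1 i).card : ℝ) / (S.card * T.card : ℕ)) (hdB : ∀ j k, dB j k = (((T ×ˢ U).filter fun tu => tu.2 k = tu.1 j).card : ℝ) / (T.card * U.card : ℕ)) (hdC : ∀ k i, dC k i = (((U ×ˢ S).filter fun us => us.2 i = us.1 k).card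 : ℝ) / (U.card * S.card : ℕ)) (θC : ℝ) (hθC : 16 / (n : ℝ) ≤ θC) (hpB : ∀ j k, pB j k = if 16 / (n : ℝ) ≤ dB j k then dB j k - 1 / n else 0) (hpC : ∀ k i, pC k i = if θC ≤ dC k i then dC k i - 1 / n else 0) (ε₁ ε₂ h₁ M A₀ P W A₁ : ℝ) (hε₁ : 0 < ε₁) (hε₂ : 0 < ε₂) (hε₂1 : ε₂ ≤ 1) (hh₁ : 0 < h₁) (hP0 : 0 ≤ P) (hM : 56 * (((⌊Real.logb 2 ((n : ℝ) ^ 2)⌋₊ + 1 : ℕ) : ℝ) * ((⌊Real.logb 2 ((n : ℝ) ^ 2)⌋₊ + 1 : ℕ) : ℝ)) ≤ M) (hA₀ : 5000 * n * (1 + Real.log n) * Real.log (4 * ((n.factorial : ℝ) / (S.card * T.card : ℕ)) / ε₂) / ε₂ ^ 2 ≤ A₀) (hA₀n : (n : ℝ) ≤ A₀) (hA₀log : Real.log A₀ ≤ 101 / 100 * Real.log n) (hPlow : A₀ ^ 2 * (n : ℝ) ^ (-(151 / 100 : ℝ)) ≤ P * ε₁ ^ 2) (hW : 10 ^ 7 *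 (1 + Real.log n) ^ 2 * (Real.log (4 * ((n.factorial : ℝ) / (S.card * T.card : ℕ)) / ε₂)) ^ 2 * n * B / (ε₂ ^ 4 * h₁ ^ 2) + 20 * (1 + M) * A₀ ^ 2 * B / (h₁ ^ 2 * n) + n * P * B + 20 * (1 + M) * A₁ ^ 2 * B / (h₁ ^ 2 * n) ≤ W) (hN : W < ((S.card * T.card * U.card : ℕ) : ℝ)) (Qm R : Finset (Fin n)) (σ σ' x ρ ρ' y : Fin n → Fin (⌊Real.logb 2 ((n : ℝ) ^ 2)⌋₊ + 1) → ℝ) (hσ : ∀ k a, σ k a = ∑ j ∈ Finset.univ.filter (fun j => 16 / (n : ℝ) ≤ dB j k ∧ ⌊Real.logb 2 (1 / dB j k)⌋₊ = a.val), pB j k) (hσ' : ∀ k a, σ' k a = ∑ j ∈ Finset.univ.filter (fun j => 16 / (n : ℝ) ≤ dB j k ∧ ⌊Real.logb 2 (1 / dB j k)⌋₊ = a.val), dB j k) (hx : ∀ k a, x k a = max (((Finset.univ.filter (fun j => 16 / (n : ℝ) ≤ dB j k ∧ ⌊Real.logb 2 (1 / dB j k)⌋₊ = a.val)).card : ℝ))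 1) (hρ : ∀ k b, ρ k b = ∑ i ∈ Finset.univ.filter (fun i => i ∉ Qm ∧ θC ≤ dC k i ∧ ⌊Real.logb 2 (1 / dC k i)⌋₊ = b.val), pC k i) (hρ' : ∀ k b, ρ' k b = ∑ i ∈ Finset.univ.filter (fun i => i ∉ Qm ∧ θC ≤ dC k i ∧ ⌊Real.logb 2 (1 / dC k i)⌋₊ = b.val), dC k i) (hy : ∀ k b, y k b = max (((Finset.univ.filter (fun i => i ∉ Qm ∧ θC ≤ dC k i ∧ ⌊Real.logb 2 (1 / dC k i)⌋₊ = b.val)).card : ℝ)) 1) (Ψ : Fin n → Fin (⌊Real.logb 2 ((n : ℝ) ^ 2)⌋₊ + 1) → Fin (⌊Real.logb 2 ((n : ℝ) ^ 2)⌋₊ + 1) → ℝ) (hΨ : ∀ k a b, Ψ k a b = ∑ i ∈ Finset.univ.filter (fun i => i ∉ Qm ∧ θC ≤ dC k i ∧ ⌊Real.logb 2 (1 / dC k i)⌋₊ = b.val), ∑ j ∈ Finset.univ.filter (fun j => 16 / (n : ℝ) ≤ dB j k ∧ ⌊Real.logb 2 (1 / dB j k)⌋₊ = a.val), dA i j *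 pB j k * pC k i) : 245 / 1000 * ((∑ k ∈ R, ∑ a, if ε₁ ≤ σ k a ∧ ∃ b, ε₁ ≤ ρ k b ∧ Ψ k a b ≤ (1 - ε₂) * (σ k a * ρ k b) / n then σ' k a else 0) + (∑ k ∈ R, ∑ b, if ε₁ ≤ ρ k b ∧ ∃ a, ε₁ ≤ σ k a ∧ Ψ k a b ≤ (1 - ε₂) * (σ k a * ρ k b) / n then ρ' k b else 0)) ≤ (∑ k ∈ R, ∑ a, if ε₁ ≤ σ k a ∧ ∃ b, ε₁ ≤ ρ k b ∧ Ψ k a b ≤ (1 - ε₂) * (σ k a * ρ k b) / n then σ' k a * (1 - Real.log (x k a) / Real.log n) else 0) + (∑ k ∈ R, ∑ b, if ε₁ ≤ ρ k b ∧ ∃ a, ε₁ ≤ σ k a ∧ Ψ k a b ≤ (1 - ε₂) * (σ k a * ρ k b) / n then ρ' k b * (1 - Real.log (y k b) / Real.log n) else 0) := by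
  have hn2 : (2 : ℝ) ≤ n := by exact_mod_cast hn
  have hlog0 : 0 < Real.log n := Real.log_pos (by linarith)
  have hdB0 : ∀ j k, 0 ≤ dB j k := fun j k => by rw [hdB]; positivity
  have hdC0 : ∀ k i, 0 ≤ dC k i := fun k i => by rw [hdC]; positivity
  have hσ'0 : ∀ k a, 0 ≤ σ' k a := fun k a => by
    rw [hσ']; exact Finset.sum_nonneg fun j _ => hdB0 j k
  have hρ'0 : ∀ k b, 0 ≤ ρ' k b := fun k b => by
    rw [hρ']; exact Finset.sum_nonneg fun i _ => hdC0 k i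
  -- the rate box at every row `k`
  have hrate := fun k => incl_rate_bounds_masked hn B hB hTPP hS0 hT0 hU0 dA dB dC pB pC hdA hdB hdC
    (16 / (n : ℝ)) θC le_rfl hθC hpB hpC ε₁ ε₂ h₁ M A₀ P W A₁ hε₁ hε₂ hε₂1 hh₁ hP0 hM hA₀ hA₀n
    hA₀log hPlow hW hN k Qm (σ k) (σ' k) (x k) (ρ k) (ρ' k) (y k) (hσ k) (hσ' k) (hx k) (hρ k)
    (hρ' k) (hy k) (Ψ k) (hΨ k)
  -- an included level of rate `log x ≤ 0.755 log n` costs at least `0.245` of its mass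
  have hkey : ∀ s l : ℝ, 0 ≤ s → l ≤ 755 / 1000 * Real.log n →
      245 / 1000 * s ≤ s * (1 - l / Real.log n) := by
    intro s l hs hl
    have h1 : l / Real.log n ≤ 755 / 1000 := by rwa [div_le_iff₀ hlog0]
    calc 245 / 1000 * s = s * (245 / 1000) := mul_comm _ _
      _ ≤ s * (1 - l / Real.log n) := mul_le_mul_of_nonneg_left (by linarith) hs
  have hT : ∀ k, 245 / 1000 * (∑ a, if ε₁ ≤ σ k a ∧ ∃ b, ε₁ ≤ ρ k b ∧
      Ψ k a b ≤ (1 - ε₂) * (σ k a * ρ k b) / n then σ' k a else 0) ≤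
      ∑ a, if ε₁ ≤ σ k a ∧ ∃ b, ε₁ ≤ ρ k b ∧ Ψ k a b ≤ (1 - ε₂) * (σ k a * ρ k b) / n then
        σ' k a * (1 - Real.log (x k a) / Real.log n) else 0 := by
    intro k
    rw [Finset.mul_sum]
    refine Finset.sum_le_sum fun a _ => ?_
    split_ifs with h
    · exact hkey _ _ (hσ'0 k a) ((hrate k).1 a h).2
    · simp
  have hS : ∀ k, 245 / 1000 * (∑ b, if ε₁ ≤ ρ k b ∧ ∃ a, ε₁ ≤ σ k a ∧
      Ψ k a b ≤ (1 - ε₂) * (σ k a * ρ k b) / n then ρ' k b else 0) ≤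
      ∑ b, if ε₁ ≤ ρ k b ∧ ∃ a, ε₁ ≤ σ k a ∧ Ψ k a b ≤ (1 - ε₂) * (σ k a * ρ k b) / n then
        ρ' k b * (1 - Real.log (y k b) / Real.log n) else 0 := by
    intro k
    rw [Finset.mul_sum]
    refine Finset.sum_le_sum fun b _ => ?_
    split_ifs with h
    · exact hkey _ _ (hρ'0 k b) ((hrate k).2 b h).2
    · simp
  rw [mul_add, Finset.mul_sum, Finset.mul_sum]
  exact add_le_add (Finset.sum_le_sum fun k _ => hT k) (Finset.sum_le_sum fun k _ => hS k)


/-- **The two halves of the cover, bounded.**  For a TPP triple `(S, T, U)` with profiles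
`dA, dB, dC`, heavy part `pC` of `dC` (threshold `θC ≥ 16/n`, heavy mass `≤ Λ`), hub rows `R` and hub
columns `Q` with `2(|R|+|Q|)² ≤ n`, and the processed parameter facts of `rows_kept_le` for BOTH
co-densities `K_A = n!/(|S||T|)` and `K_B = n!/(|U||T|)` under the no-win hypothesis `W < N`: there are
reals `COST` (the four entropy costs of the included levels) and `MASS ≥ 0` (their included mass) with
`0.245 MASS ≤ COST` (rate box), `COST log n ≤ log K_A + log K_B + log K_C + MASS log((2|R|+2|Q|+2)/ε₁) + 6`
(`costs_certified_with_mass`) and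
`ROWS + COLS ≤ 5/8 COST + slop(|R|) + slop(|Q|)` (`rows_kept_le` for the rows `R` with mask `Q`, and for
the rows `Q` of the reversed triple `(U, T, S)` with mask `∅`). [folklore] -/
theorem atomsTrichotomy_halves {n : ℕ} (hn : 2 ≤ n) (B : ℕ) (hB : ∀ S' T' U' : Finset (Equiv.Perm (Fin (n - 1))), TripleProductProperty S' T' U' → S'.card * T'.card * U'.card ≤ B) {S T U : Finset (Equiv.Perm (Fin n))} (hTPP : TripleProductProperty S T U) (hS0 : S.Nonempty) (hT0 : T.Nonempty) (hU0 : U.Nonempty) (dA dB dC pC : Fin n → Fin n → ℝ) (hdA : ∀ i j, dA i j = (((S ×ˢ T).filter fun st => st.2 j = st.1 i).card : ℝ) / (S.card * T.card : ℕ)) (hdB : ∀ j k, dB j k = (((T ×ˢ U).filter fun tu => tu.2 k = tu.1 j).card : ℝ) / (T.card * U.card : ℕ)) (hdC : ∀ k i, dC k i = (((U ×ˢ S).filter fun us => us.2 i = us.1 k).card : ℝ) / (U.card * S.card : ℕ)) (θC Λ : ℝ) (hθC : 16 / (n : ℝ) ≤ θC) (hpC : ∀ k i, pC k i = if θC ≤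 dC k i then dC k i - 1 / n else 0) (hmassC : ∑ k : Fin n, ∑ i : Fin n, (if θC ≤ dC k i then dC k i else 0) ≤ Λ) (ε₁ ε₂ h₁ M A₀ P W A₁ mR : ℝ) (hmR : mR = ((⌊Real.logb 2 ((n : ℝ) ^ 2)⌋₊ + 1 : ℕ) : ℝ)) (hε₁ : 0 < ε₁) (hε₂ : 0 < ε₂) (hε₂1 : ε₂ ≤ 1) (hε₁n : 32 ≤ ε₁ * (n : ℝ) ^ (245 / 1000 : ℝ)) (hh₁ : 0 < h₁) (hP0 : 0 ≤ P) (hM : 56 * (mR * mR) ≤ M) (hA₀A : 5000 * n * (1 + Real.log n) * Real.log (4 * ((n.factorial : ℝ) / (S.card * T.card : ℕ)) / ε₂) / ε₂ ^ 2 ≤ A₀) (hA₀B : 5000 * n * (1 + Real.log n) * Real.log (4 * ((n.factorial : ℝ) / (U.card * T.card : ℕ)) / ε₂) / ε₂ ^ 2 ≤ A₀) (hA₀n : (n : ℝ) ≤ A₀) (hA₀log : Real.log A₀ ≤ 101 / 100 * Real.log n) (hA₁ : 124 / 100 * Real.log n ≤ Real.log A₁) (hA₀₁ : A₀ ≤ A₁)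 (hPlow : A₀ ^ 2 * (n : ℝ) ^ (-(151 / 100 : ℝ)) ≤ P * ε₁ ^ 2) (hWA : 10 ^ 7 * (1 + Real.log n) ^ 2 * (Real.log (4 * ((n.factorial : ℝ) / (S.card * T.card : ℕ)) / ε₂)) ^ 2 * n * B / (ε₂ ^ 4 * h₁ ^ 2) + 20 * (1 + M) * A₀ ^ 2 * B / (h₁ ^ 2 * n) + n * P * B + 20 * (1 + M) * A₁ ^ 2 * B / (h₁ ^ 2 * n) ≤ W) (hWB : 10 ^ 7 * (1 + Real.log n) ^ 2 * (Real.log (4 * ((n.factorial : ℝ) / (U.card * T.card : ℕ)) / ε₂)) ^ 2 * n * B / (ε₂ ^ 4 * h₁ ^ 2) + 20 * (1 + M) * A₀ ^ 2 * B / (h₁ ^ 2 * n) + n * P * B + 20 * (1 + M) * A₁ ^ 2 * B / (h₁ ^ 2 * n) ≤ W) (hN : W < ((S.card * T.card * U.card : ℕ) : ℝ)) (R Q : Finset (Fin n)) (hRQ : 2 * ((R.card : ℝ) + Q.card) ^ 2 ≤ n) : ∃ COST MASS : ℝ, 0 ≤ MASS ∧ 245 / 1000 * MASS ≤ COST ∧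 COST * Real.log n ≤ Real.log ((n.factorial : ℝ) / (S.card * T.card : ℕ)) + Real.log ((n.factorial : ℝ) / (T.card * U.card : ℕ)) + Real.log ((n.factorial : ℝ) / (U.card * S.card : ℕ)) + (MASS * Real.log ((2 * (R.card : ℝ) + 2 * (Q.card : ℝ) + 2) / ε₁) + 6) ∧ ∑ k ∈ R, ((n : ℝ) - 1) * ∑ i ∈ Finset.univ.filter (fun i => i ∉ Q), pC k i * ∑ j : Fin n, dB j k * (1 / n - dA i j) + ∑ i ∈ Q, ((n : ℝ) - 1) * ∑ k ∈ Finset.univ.filter (fun k => k ∉ (∅ : Finset (Fin n))), pC k i * ∑ j : Fin n, dA i j * (1 / n - dB j k) ≤ 5 / 8 * COST + (((2 * ε₂ + 5 * (1 + Real.log n) * ε₁ + 1 / n) * Λ + (R.card : ℝ) * (4 * ε₁ * mR + 4 * (mR * mR) * h₁ + 4 * (mR * mR) / M + 5 * (1 + Real.log n) * ε₁)) + ((2 * ε₂ + 5 * (1 + Real.log n) * ε₁ + 1 / n) * Λ + (Q.card : ℝ) * (4 * ε₁ * mR + 4 * (mR * mR) * h₁ + 4 * (mR * mR) / M + 5 *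 (1 + Real.log n) * ε₁))) := by
  subst hmR
  have hn0 : 0 < n := by omega
  /- (1) the heavy parts at threshold `16/n` of the columns of `dB` (rows) and of the rows of `dA`
  (columns), and the level data of the hub rows (mask `Q`) and of the hub columns (mask `∅`) -/
  obtain ⟨pB, hpB⟩ : ∃ f : Fin n → Fin n → ℝ, ∀ j k,
      f j k = if 16 / (n : ℝ) ≤ dB j k then dB j k - 1 / n else 0 := ⟨_, fun _ _ => rfl⟩
  obtain ⟨pBc, hpBc⟩ : ∃ f : Fin n → Fin n → ℝ, ∀ j i,
      f j i = if 16 / (n : ℝ) ≤ dA i j then dA i j - 1 / n else 0 := ⟨_, fun _ _ => rfl⟩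
  obtain ⟨σ, hσ⟩ : ∃ f : Fin n → Fin (⌊Real.logb 2 ((n : ℝ) ^ 2)⌋₊ + 1) → ℝ, ∀ k a, f k a =
      ∑ j ∈ Finset.univ.filter (fun j => 16 / (n : ℝ) ≤ dB j k ∧ ⌊Real.logb 2 (1 / dB j k)⌋₊ = a.val),
        pB j k := ⟨_, fun _ _ => rfl⟩
  obtain ⟨σ', hσ'⟩ : ∃ f : Fin n → Fin (⌊Real.logb 2 ((n : ℝ) ^ 2)⌋₊ + 1) → ℝ, ∀ k a, f k a =
      ∑ j ∈ Finset.univ.filter (fun j => 16 / (n : ℝ) ≤ dB j k ∧ ⌊Real.logb 2 (1 / dB j k)⌋₊ = a.val),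
        dB j k := ⟨_, fun _ _ => rfl⟩
  obtain ⟨x, hx⟩ : ∃ f : Fin n → Fin (⌊Real.logb 2 ((n : ℝ) ^ 2)⌋₊ + 1) → ℝ, ∀ k a, f k a =
      max (((Finset.univ.filter (fun j => 16 / (n : ℝ) ≤ dB j k ∧
        ⌊Real.logb 2 (1 / dB j k)⌋₊ = a.val)).card : ℝ)) 1 := ⟨_, fun _ _ => rfl⟩
  obtain ⟨ρ, hρ⟩ : ∃ f : Fin n → Fin (⌊Real.logb 2 ((n : ℝ) ^ 2)⌋₊ + 1) → ℝ, ∀ k b, f k b =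
      ∑ i ∈ Finset.univ.filter (fun i => i ∉ Q ∧ θC ≤ dC k i ∧ ⌊Real.logb 2 (1 / dC k i)⌋₊ = b.val),
        pC k i := ⟨_, fun _ _ => rfl⟩
  obtain ⟨ρ', hρ'⟩ : ∃ f : Fin n → Fin (⌊Real.logb 2 ((n : ℝ) ^ 2)⌋₊ + 1) → ℝ, ∀ k b, f k b =
      ∑ i ∈ Finset.univ.filter (fun i => i ∉ Q ∧ θC ≤ dC k i ∧ ⌊Real.logb 2 (1 / dC k i)⌋₊ = b.val),
        dC k i := ⟨_, fun _ _ => rfl⟩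
  obtain ⟨y, hy⟩ : ∃ f : Fin n → Fin (⌊Real.logb 2 ((n : ℝ) ^ 2)⌋₊ + 1) → ℝ, ∀ k b, f k b =
      max (((Finset.univ.filter (fun i => i ∉ Q ∧ θC ≤ dC k i ∧
        ⌊Real.logb 2 (1 / dC k i)⌋₊ = b.val)).card : ℝ)) 1 := ⟨_, fun _ _ => rfl⟩
  obtain ⟨Ψ, hΨ⟩ : ∃ f : Fin n → Fin (⌊Real.logb 2 ((n : ℝ) ^ 2)⌋₊ + 1) →
      Fin (⌊Real.logb 2 ((n : ℝ) ^ 2)⌋₊ + 1) → ℝ, ∀ k a b, f k a b =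
      ∑ i ∈ Finset.univ.filter (fun i => i ∉ Q ∧ θC ≤ dC k i ∧ ⌊Real.logb 2 (1 / dC k i)⌋₊ = b.val),
        ∑ j ∈ Finset.univ.filter (fun j => 16 / (n : ℝ) ≤ dB j k ∧
          ⌊Real.logb 2 (1 / dB j k)⌋₊ = a.val), dA i j * pB j k * pC k i := ⟨_, fun _ _ _ => rfl⟩
  obtain ⟨σc, hσc⟩ : ∃ f : Fin n → Fin (⌊Real.logb 2 ((n : ℝ) ^ 2)⌋₊ + 1) → ℝ, ∀ i a, f i a =
      ∑ j ∈ Finset.univ.filter (fun j => 16 / (n : ℝ) ≤ dA i j ∧ ⌊Real.logb 2 (1 / dA i j)⌋₊ = a.val),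
        pBc j i := ⟨_, fun _ _ => rfl⟩
  obtain ⟨σc', hσc'⟩ : ∃ f : Fin n → Fin (⌊Real.logb 2 ((n : ℝ) ^ 2)⌋₊ + 1) → ℝ, ∀ i a, f i a =
      ∑ j ∈ Finset.univ.filter (fun j => 16 / (n : ℝ) ≤ dA i j ∧ ⌊Real.logb 2 (1 / dA i j)⌋₊ = a.val),
        dA i j := ⟨_, fun _ _ => rfl⟩
  obtain ⟨xc, hxc⟩ : ∃ f : Fin n → Fin (⌊Real.logb 2 ((n : ℝ) ^ 2)⌋₊ + 1) → ℝ, ∀ i a, f i a =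
      max (((Finset.univ.filter (fun j => 16 / (n : ℝ) ≤ dA i j ∧
        ⌊Real.logb 2 (1 / dA i j)⌋₊ = a.val)).card : ℝ)) 1 := ⟨_, fun _ _ => rfl⟩
  obtain ⟨ρc, hρc⟩ : ∃ f : Fin n → Fin (⌊Real.logb 2 ((n : ℝ) ^ 2)⌋₊ + 1) → ℝ, ∀ i b, f i b =
      ∑ k ∈ Finset.univ.filter (fun k => k ∉ (∅ : Finset (Fin n)) ∧ θC ≤ dC k i ∧
        ⌊Real.logb 2 (1 / dC k i)⌋₊ = b.val), pC k i := ⟨_, fun _ _ => rfl⟩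
  obtain ⟨ρc', hρc'⟩ : ∃ f : Fin n → Fin (⌊Real.logb 2 ((n : ℝ) ^ 2)⌋₊ + 1) → ℝ, ∀ i b, f i b =
      ∑ k ∈ Finset.univ.filter (fun k => k ∉ (∅ : Finset (Fin n)) ∧ θC ≤ dC k i ∧
        ⌊Real.logb 2 (1 / dC k i)⌋₊ = b.val), dC k i := ⟨_, fun _ _ => rfl⟩
  obtain ⟨yc, hyc⟩ : ∃ f : Fin n → Fin (⌊Real.logb 2 ((n : ℝ) ^ 2)⌋₊ + 1) → ℝ, ∀ i b, f i b =
      max (((Finset.univ.filter (fun k => k ∉ (∅ : Finset (Fin n)) ∧ θC ≤ dC k i ∧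
        ⌊Real.logb 2 (1 / dC k i)⌋₊ = b.val)).card : ℝ)) 1 := ⟨_, fun _ _ => rfl⟩
  obtain ⟨Ψc, hΨc⟩ : ∃ f : Fin n → Fin (⌊Real.logb 2 ((n : ℝ) ^ 2)⌋₊ + 1) →
      Fin (⌊Real.logb 2 ((n : ℝ) ^ 2)⌋₊ + 1) → ℝ, ∀ i a b, f i a b =
      ∑ k ∈ Finset.univ.filter (fun k => k ∉ (∅ : Finset (Fin n)) ∧ θC ≤ dC k i ∧
        ⌊Real.logb 2 (1 / dC k i)⌋₊ = b.val),
        ∑ j ∈ Finset.univ.filter (fun j => 16 / (n : ℝ) ≤ dA i j ∧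
          ⌊Real.logb 2 (1 / dA i j)⌋₊ = a.val), dB j k * pBc j i * pC k i := ⟨_, fun _ _ _ => rfl⟩
  /- (2) the heavy masses of the hub rows (masked) and of the hub columns are `≤ Λ` -/
  have hdC0 : ∀ k i, 0 ≤ dC k i := fun k i => by rw [hdC]; positivity
  have hg0 : ∀ k i, (0 : ℝ) ≤ (if θC ≤ dC k i then dC k i else 0) := fun k i => by
    split_ifs
    · exact hdC0 k i
    · exact le_rfl
  have hΛR : ∑ k ∈ R, ∑ i ∈ Finset.univ.filter (fun i => i ∉ Q),
      (if θC ≤ dC k i then dC k i else 0) ≤ Λ :=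
    calc _ ≤ ∑ k ∈ R, ∑ i, (if θC ≤ dC k i then dC k i else 0) :=
          Finset.sum_le_sum fun k _ => Finset.sum_le_sum_of_subset_of_nonneg
            (Finset.filter_subset _ _) fun i _ _ => hg0 k i
      _ ≤ ∑ k, ∑ i, (if θC ≤ dC k i then dC k i else 0) :=
          Finset.sum_le_sum_of_subset_of_nonneg (Finset.subset_univ R)
            fun k _ _ => Finset.sum_nonneg fun i _ => hg0 k i
      _ ≤ Λ := hmassC
  have hΛQ : ∑ i ∈ Q, ∑ k ∈ Finset.univ.filter (fun k => k ∉ (∅ : Finset (Fin n))),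
      (if θC ≤ dC k i then dC k i else 0) ≤ Λ :=
    calc _ ≤ ∑ i ∈ Q, ∑ k, (if θC ≤ dC k i then dC k i else 0) :=
          Finset.sum_le_sum fun i _ => Finset.sum_le_sum_of_subset_of_nonneg
            (Finset.filter_subset _ _) fun k _ _ => hg0 k i
      _ ≤ ∑ i, ∑ k, (if θC ≤ dC k i then dC k i else 0) :=
          Finset.sum_le_sum_of_subset_of_nonneg (Finset.subset_univ Q)
            fun i _ _ => Finset.sum_nonneg fun k _ => hg0 k i
      _ = ∑ k, ∑ i, (if θC ≤ dC k i then dC k i else 0) := Finset.sum_comm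
      _ ≤ Λ := hmassC
  /- (3) the hub rows: `rows_kept_le` and `rows_rate_le` for `(S, T, U)`, rows `R`, mask `Q` -/
  have hrows := rows_kept_le hn B hB hTPP hS0 hT0 hU0 dA dB dC pB pC hdA hdB hdC θC hθC hpB hpC ε₁ ε₂
    h₁ M A₀ P W A₁ hε₁ hε₂ hε₂1 hε₁n hh₁ hP0 hM hA₀A hA₀n hA₀log hA₁ hA₀₁ hPlow hWA hN Q R Λ σ σ' x
    ρ ρ' y hσ hσ' hx hρ hρ' hy Ψ hΨ hΛR
  have hrate1 := rows_rate_le hn B hB hTPP hS0 hT0 hU0 dA dB dC pB pC hdA hdB hdC θC hθC hpB hpC ε₁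
    ε₂ h₁ M A₀ P W A₁ hε₁ hε₂ hε₂1 hh₁ hP0 hM hA₀A hA₀n hA₀log hPlow hWA hN Q R σ σ' x ρ ρ' y hσ
    hσ' hx hρ hρ' hy Ψ hΨ
  /- (4) the hub columns: the same for the reversed triple `(U, T, S)`, rows `Q`, mask `∅` -/
  have hTPPr := tpp_reverse hTPP
  obtain ⟨hdAr, hdBr, hdCr⟩ := reversed_profiles S T U dA dB dC hdA hdB hdC
  have hvol : U.card * T.card * S.card = S.card * T.card * U.card := by ring
  have hNr : W < ((U.card * T.card * S.card : ℕ) : ℝ) := by rwa [hvol]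
  have hcols := rows_kept_le hn B hB hTPPr hU0 hT0 hS0 (fun i j => dB j i) (fun j k => dA k j)
    (fun k i => dC i k) pBc (fun k i => pC i k) hdAr hdBr hdCr θC hθC hpBc (fun k i => hpC i k)
    ε₁ ε₂ h₁ M A₀ P W A₁ hε₁ hε₂ hε₂1 hε₁n hh₁ hP0 hM hA₀B hA₀n hA₀log hA₁ hA₀₁ hPlow hWB hNr ∅ Q Λ
    σc σc' xc ρc ρc' yc hσc hσc' hxc hρc hρc' hyc Ψc hΨc hΛQ
  have hrate2 := rows_rate_le hn B hB hTPPr hU0 hT0 hS0 (fun i j => dB j i) (fun j k => dA k j)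
    (fun k i => dC i k) pBc (fun k i => pC i k) hdAr hdBr hdCr θC hθC hpBc (fun k i => hpC i k)
    ε₁ ε₂ h₁ M A₀ P W A₁ hε₁ hε₂ hε₂1 hh₁ hP0 hM hA₀B hA₀n hA₀log hPlow hWB hNr ∅ Q σc σc' xc ρc
    ρc' yc hσc hσc' hxc hρc hρc' hyc Ψc hΨc
  /- (5) the four costs, certified, and assembly -/
  obtain ⟨hcert, hM0, -⟩ := costs_certified_with_mass hn hTPP hS0 hT0 hU0 dA dB dC pB pC pBc hdA
    hdB hdC θC hpB hpC hpBc ε₁ ε₂ hε₁ R Q hRQ σ σ' x ρ ρ' y hσ hσ' hx hρ hρ' hy Ψ σc σc' xc ρc ρc'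
    yc hσc hσc' hxc hρc hρc' hyc Ψc
  rw [Finset.sum_add_distrib] at hrows hcols
  exact ⟨_, _, hM0, by linarith, hcert, by linarith⟩

end Summit.MatrixMultiplication.MatrixMultiplication.Theorems.PolynomialSlack
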